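import Summits.QuantumAdvantage.QuantumAdvantage.Theorems.SosSandwichTransferPBTruncatedRuns
import Literature.Computability.QuantumComplexity.QueryWeightsAdditive
import HarnessLib

/-!
# Crux `TransferPB` (stmt-QuantumAdvantage-15238, route SosSandwich), line `birth` — the truncated-runs estimator: BLOCK semantics

Sequel of `Theorems/SosSandwichTransferPBTruncatedRuns.lean` (the estimator `truncRun F nOf`, MEAN and SINGLE semantics). The
BLOCK node test `⟨x, ρ, u⟩` compares `blockMag F x ρ u = Σ_{s : u ⊑ σ(s)} bbbvMag F x ρ s` with the threshold; on the
estimator it is ONE event per block — "the query register of block `b` spells a relevant string with prefix `u`" — by the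
additivity of query magnitudes in the target set (`Literature/…/QueryWeightsAdditive.lean`):

* **`sum_kernelProb_truncRun_prefix_eq_blockMag`** — on an instance well laid out for `(x, ρ, t, pad)`,
  `4T · Σ_{b<T} Pr[query register of block b ∈ {σ(s) : u ⊑ σ(s)}] = blockMag F x ρ u`, EXACTLY.

All proved; no definition, no named fact. Sources: C. H. Bennett, E. Bernstein, G. Brassard, U. Vazirani, SIAM J. Comput.
26 (1997), Def. 3.2 / Cor. 3.4; M. Zhandry, CRYPTO 2012, Thm. 3.1; S. Aaronson, A. Ambainis, Theory Comput. 10 (2014),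
proof of Thm. 23 (p. 14).
-/

-- D-0017: single-conjunct summit ⇒ the duplicate `QuantumAdvantage.QuantumAdvantage` is mandated.
set_option linter.dupNamespace false

noncomputable section

namespace Summit.QuantumAdvantage.QuantumAdvantage.Cruxes.TransferPB.Birth

open Finset Literature.Computability.Cryptography Literature.Computability.Complexity
  Literature.Computability.QuantumComplexity Literature.Computability.QuantumComplexity.ClassicalSimulation
  Literature.Computability.Cryptography.ExplicitKWiseHash

namespace SimTreePB

variable {F : QCircuitFamily cliffordT}

/-- **The BLOCK semantics of the truncated-runs estimator.** On an instance `z` well laid out for `(x, ρ, t, pad)`,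
`4T · Σ_{b<T} Pr[the transported query register of block b spells a relevant string with prefix u] = blockMag F x ρ u`.
[cite: BennettBernsteinBrassardVazirani1997, Def. 3.2, Cor. 3.4] [cite: Zhandry2012IBE, Thm. 3.1] -/
theorem sum_kernelProb_truncRun_prefix_eq_blockMag (nOf : ℕ → ℕ) (z x : List Bool)
    (ρ : List (Fin (numOracleBits F x) × Bool)) (t pad : List Bool)
    (hn : (truncRun F nOf).nOf z.length = x.length)
    (hseg : ∀ b, (truncRun F nOf).inpB z b = fun i : Fin ((truncRun F nOf).nOf z.length) => x.getD (i : ℕ) false)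
    (hdrop : z.drop ((truncRun F nOf).MOf z.length * (truncRun F nOf).nOf z.length) =
      paramStr (boolPair x (boolPair (encPath F x ρ) t)) pad)
    (u : List Bool) :
    4 * ((F.circ x.length).oracleQueries : ℝ) *
      ∑ b : Fin (oraclePositions (F.circ ((truncRun F nOf).nOf z.length)).gates).length,
        (truncRun F nOf).family.kernelProb (keyedLang F) z
          {s' | queryOf ((oraclePositions (F.circ ((truncRun F nOf).nOf z.length)).gates)[(b : ℕ)]).2.2
            (fun i => s'.getD (((truncRun F nOf).E z.length
              ⟨b, by rw [KeyedBlocks.trunc_MOf, ← length_oraclePositions]; exact Nat.lt_succ_of_lt b.2⟩ i :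
                Fin (z.length + (truncRun F nOf).anc z.length)) : ℕ) false) ∈
            {q : List Bool | ∃ s ∈ univ.filter (fun s : Fin (numOracleBits F x) => u <+: bitString F x s), bitString F x s = q}} =
      blockMag F x ρ u := by
  classical
  set S : Finset (Fin (numOracleBits F x)) := univ.filter (fun s : Fin (numOracleBits F x) => u <+: bitString F x s) with hS
  have hσ : Set.InjOn (bitString F x) (S : Set (Fin (numOracleBits F x))) := fun a _ b _ h => bitString_injective F x h
  -- every block by the truncated-run identity and additivity in the target set
  have hb : ∀ b : Fin (oraclePositions (F.circ ((truncRun F nOf).nOf z.length)).gates).length,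
      (truncRun F nOf).family.kernelProb (keyedLang F) z
          {s' | queryOf ((oraclePositions (F.circ ((truncRun F nOf).nOf z.length)).gates)[(b : ℕ)]).2.2
            (fun i => s'.getD (((truncRun F nOf).E z.length
              ⟨b, by rw [KeyedBlocks.trunc_MOf, ← length_oraclePositions]; exact Nat.lt_succ_of_lt b.2⟩ i :
                Fin (z.length + (truncRun F nOf).anc z.length)) : ℕ) false) ∈
            {q : List Bool | ∃ s ∈ S, bitString F x s = q}} =
        (1 / 2 : ℝ) ^ keyPoly.eval (kOf F ((truncRun F nOf).nOf z.length) + mOf F ((truncRun F nOf).nOf z.length)) *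
          ∑ key : QReg (keyPoly.eval (kOf F ((truncRun F nOf).nOf z.length) + mOf F ((truncRun F nOf).nOf z.length))),
            ∑ s ∈ S, (queryWeights (prefixSlice (keyedLang F) (paramStr (boolPair x (boolPair (encPath F x ρ) t)) pad ++ List.ofFn key))
              ({bitString F x s} : Set (List Bool)) (F.circ ((truncRun F nOf).nOf z.length)).gates
              (basisState (padInput (fun i : Fin ((truncRun F nOf).nOf z.length) => x.getD (i : ℕ) false)
                (F.ancillas ((truncRun F nOf).nOf z.length)))))[(b : ℕ)]'(by
                  rw [queryWeights_eq_map_oraclePositions, List.length_map]; exact b.2) := by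
    intro b
    have h := KeyedBlocks.trunc_kernelProb_query F nOf _ (keyedLang F) z
      ⟨b, by rw [KeyedBlocks.trunc_MOf, ← length_oraclePositions]; exact Nat.lt_succ_of_lt b.2⟩ b.2
      {q : List Bool | ∃ s ∈ S, bitString F x s = q}
    rw [h]
    simp only [hdrop, hseg]
    congr 1
    refine Finset.sum_congr rfl fun key _ => ?_
    exact queryWeights_getElem_setOf_exists_eq_sum S (bitString F x) hσ _ _ _ _ b.2
  rw [Finset.sum_congr rfl fun b _ => hb b, ← Finset.mul_sum]
  -- Σ_b Σ_key Σ_s ↦ Σ_s Σ_key Σ_b, collect the list entries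
  rw [Finset.sum_comm]
  simp_rw [Finset.sum_comm (t := S)]
  have hcollect : ∀ (key : QReg (keyPoly.eval (kOf F ((truncRun F nOf).nOf z.length) + mOf F ((truncRun F nOf).nOf z.length))))
      (s : Fin (numOracleBits F x)),
      (∑ b : Fin (oraclePositions (F.circ ((truncRun F nOf).nOf z.length)).gates).length,
        (queryWeights (prefixSlice (keyedLang F) (paramStr (boolPair x (boolPair (encPath F x ρ) t)) pad ++ List.ofFn key))
          ({bitString F x s} : Set (List Bool)) (F.circ ((truncRun F nOf).nOf z.length)).gates
          (basisState (padInput (fun i : Fin ((truncRun F nOf).nOf z.length) => x.getD (i : ℕ) false)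
            (F.ancillas ((truncRun F nOf).nOf z.length)))))[(b : ℕ)]'(by
              rw [queryWeights_eq_map_oraclePositions, List.length_map]; exact b.2)) =
      (queryWeights (prefixSlice (keyedLang F) (paramStr (boolPair x (boolPair (encPath F x ρ) t)) pad ++ List.ofFn key))
          ({bitString F x s} : Set (List Bool)) (F.circ ((truncRun F nOf).nOf z.length)).gates
          (basisState (padInput (fun i : Fin ((truncRun F nOf).nOf z.length) => x.getD (i : ℕ) false)
            (F.ancillas ((truncRun F nOf).nOf z.length))))).sum :=
    fun key s => sum_getElem_eq_sum _ _ (by rw [queryWeights_eq_map_oraclePositions, List.length_map])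
  simp only [hcollect]
  -- transport `nOf |z| ↦ |x|`, then the hashed averages string by string
  have hn' : KeyedBlocks.truncNOf F nOf z.length = x.length := hn
  change 4 * ((F.circ x.length).oracleQueries : ℝ) *
      ((1 / 2 : ℝ) ^ keyPoly.eval (kOf F (KeyedBlocks.truncNOf F nOf z.length) + mOf F (KeyedBlocks.truncNOf F nOf z.length)) *
        ∑ s ∈ S, ∑ key : QReg (keyPoly.eval (kOf F (KeyedBlocks.truncNOf F nOf z.length) + mOf F (KeyedBlocks.truncNOf F nOf z.length))),
          (queryWeights (prefixSlice (keyedLang F) (paramStr (boolPair x (boolPair (encPath F x ρ) t)) pad ++ List.ofFn key))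
            ({bitString F x s} : Set (List Bool)) (F.circ (KeyedBlocks.truncNOf F nOf z.length)).gates
            (basisState (padInput (fun i : Fin (KeyedBlocks.truncNOf F nOf z.length) => x.getD (i : ℕ) false)
              (F.ancillas (KeyedBlocks.truncNOf F nOf z.length))))).sum) = _
  rw [hn', padInput_getD_eq, blockMag, Finset.mul_sum, Finset.mul_sum]
  refine Finset.sum_congr rfl fun s _ => ?_
  rw [bbbvMag_eq_hashedAvg F x (kOf F x.length) (mOf F x.length) le_rfl (by rw [mOf_length]; omega) ρ s,
    one_div, inv_pow, ← div_eq_inv_mul, ← Finset.mul_sum, mul_div_assoc]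
  congr 2
  refine Finset.sum_congr rfl fun key _ => ?_
  rw [prefixSlice_keyedLang]
  rfl

end SimTreePB

end Summit.QuantumAdvantage.QuantumAdvantage.Cruxes.TransferPB.Birth

end
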